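import Literature.AnabelianGeometry.EtaleTheta.MuTwoSettingPiCData
import Literature.AnabelianGeometry.EtaleTheta.MuTwoSettingCLevelNonVacuity
import HarnessLib

/-!
# [EtTh] §2 Def. 2.1: the profinite C-level datum `ThetaSetting.PiCData` is INHABITED at the §1 root model
# (non-vacuity witness; proof-only; GAP-LEDGER G-L2t10-2 at the model)

Mochizuki, *The étale theta function and its Frobenioid-theoretic manifestations*, Publ. RIMS **45**
(2009), §2 p. 36 (printed 262): "`Π_X ⊆ Π_C` … `1 → Δ_X → Π_X → G_K → 1`, `Δ_C := Ker(Π_C ↠ G_K)`,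
`Gal(X/C) ≅ ℤ/2ℤ`" [cite: MochizukiEtTh2009, Def 2.1 p.36]; Prop. 2.4 p. 38 (the natural injection of the
tempered group into its profinite completion) [cite: MochizukiEtTh2009, Prop 2.4 p.38].

Cell abc-iut, layer L2, non-vacuity lane (WAVE-5 prover abc-iut-w5-d221, gen 3); PROOF-ONLY (no `def`, no
`structure`, no `instance`, no `Prop`-valued fact).  abc-iut-L2-t10's parameter record
`ThetaSetting.PiCData D PiC` (`ThetaCoversModelPiC.lean`: `incl : Π_X ↪ Π_C` injective with normal range of
index `2`, `aug : Π_C → G_{ℚ_p}` extending `augHat` with range `G_K`) is the input of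
`PiCData.coverDataAx` — the GENUINE `ThetaCovers.CoverDataAx` over the arithmetic setting — and of every
`(I : D.PiCData PiC)`-quantified theorem of the §2 model lane; GAP-LEDGER row G-L2t10-2 asked for an
inhabitant "for the arithmetic setting".  abc-iut-L2-d3's `MuTwoSetting.CLevelData.piCData`
(`MuTwoSettingPiCData.lean`) CONSTRUCTS one from any C-level datum `e : M.CLevelData` (over THE injective
profinite completion `e.toPiCHat : Π^tp_C ↪ e.PiCHat`), and this seat's
`MuTwoSetting.CLevelData.nonempty_model` (`MuTwoSettingCLevelNonVacuity.lean`) inhabits `CLevelData` at the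
root model `MuTwoSetting.model p` (abc-iut-L2-t1, `SettingModelMuTwo.lean`).  Composing the two:

* `ThetaSetting.PiCData.exists_model` — `∃ P : ProfiniteGrp, Nonempty ((MuTwoSetting.model p).toThetaSetting.PiCData P)`;
* `ThetaSetting.PiCData.exists_model_over_completion` — the same with the data exposed: the witness lives
  over an INJECTIVE profinite completion `ι : Π^tp_C ↪ P` of the model's tempered `Π^tp_C`
  (`IsProfiniteCompletion ι`), its inclusion restricts to `ι ∘ inclX` on `Π^tp_X`, and its augmentation
  restricts to the model's `aug` on `Π^tp_X`.

Honest scope.  degenerate: the C-level datum underneath is this seat's product model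
`Π^tp_C = Π^tp_X × ℤ/2` (lawful for every typed clause of `CLevelData`, see `MuTwoSettingCLevelNonVacuity`);
the witness certifies that the `PiCData`-quantified §2 theorems have an inhabited domain at the root model
(consistency-level evidence), nothing about [EtTh] §2 beyond its typed clauses, and nothing about
[IUTchIII] Cor. 3.12.
-/

noncomputable section

namespace Literature.AnabelianGeometry.EtaleTheta

namespace ThetaSetting.PiCData

open Literature.AnabelianGeometry.SemiGraphs

variable (p : ℕ) [Fact p.Prime]

/-- **`PiCData` is inhabited at the root model, with its provenance exposed**: there are a profinite group
`P`, an injective profinite completion `ι : Π^tp_C → P` of the model's tempered `Π^tp_C`, and a datum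
`I : (MuTwoSetting.model p).toThetaSetting.PiCData P` whose inclusion `Π_X ↪ P` extends `ι ∘ inclX` and whose
augmentation extends the model's `aug : Π^tp_X → G_{ℚ_p}` ("`Π_X ⊆ Π_C`, `Π_C ↠ G_K`", §2 p. 36).
degenerate: built over the product C-level datum of `MuTwoSetting.CLevelData.exists_model`.
[cite: MochizukiEtTh2009, Def 2.1 p.36] -/
theorem exists_model_over_completion :
    ∃ (P : ProfiniteGrp.{0}) (ι : (MuTwoSetting.model p).GtpC →ₜ* P)
      (I : (MuTwoSetting.model p).toThetaSetting.PiCData P),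
      IsProfiniteCompletion ι ∧ Function.Injective ι ∧
      (∀ x : (MuTwoSetting.model p).PiTemp,
          I.incl ((MuTwoSetting.model p).toHat x) = ι ((MuTwoSetting.model p).inclX x)) ∧
      (∀ x : (MuTwoSetting.model p).PiTemp,
          I.aug (ι ((MuTwoSetting.model p).inclX x)) = (MuTwoSetting.model p).aug x) := by
  obtain ⟨e⟩ := MuTwoSetting.CLevelData.nonempty_model p
  exact ⟨e.PiCHat, e.toPiCHat, e.piCData, e.isProfiniteCompletion_toPiCHat, e.toPiCHat_injective,
    e.piCData_incl_toHat, e.piCData_aug_inclX⟩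

/-- **Non-vacuity of `ThetaSetting.PiCData` at the §1 root model** (GAP-LEDGER G-L2t10-2 "an inhabitant of
`ThetaSetting.PiCData D PiC` for the arithmetic setting", at `D := (MuTwoSetting.model p).toThetaSetting`):
abc-iut-L2-d3's construction `CLevelData.piCData` applied to this seat's C-level witness.
degenerate: product C-level datum underneath; consistency evidence for every
`(I : D.PiCData PiC)`-quantified theorem, nothing more. [cite: MochizukiEtTh2009, Def 2.1 p.36] -/
theorem exists_model :
    ∃ P : ProfiniteGrp.{0}, Nonempty ((MuTwoSetting.model p).toThetaSetting.PiCData P) :=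
  let ⟨P, _, I, _⟩ := exists_model_over_completion p
  ⟨P, ⟨I⟩⟩

end ThetaSetting.PiCData

end Literature.AnabelianGeometry.EtaleTheta

end
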